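import Literature.Barriers.MatrixMultiplication.IrreversibilityBarrierProofs
import Literature.NumberTheory.LFunctions.TaoLogElliottHoeffding
import Mathlib.Analysis.SpecialFunctions.Pow.Real
import HarnessLib

/-!
# Subrank of powers of a tensor with a separating weight (towards Bläser–Lysikov 2020, Thm. 16/17)

Topic `Literature/Barriers/MatrixMultiplication`; second file of the PROOF of the catalogue entry
`UnstableTensorBarrier` (`UnstableTensorBarrier.lean`: Bläser–Lysikov 2020, Thm. 16 ∧ Thm. 17).
Everything here is PROVED.

The printed proof of Thm. 17 bounds the asymptotic slice rank of an unstable tensor through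
entanglement polytopes (BL Thm. 4) and the weight margin of Bürgisser et al.; we follow the
elementary route through the Hilbert–Mumford / torus description of instability (BL §2.3,
"a more combinatorial definition of instability", [8] = BCCGNSU 2017, §4) which yields the same
shape of constant: once a tensor `s` carries real weights `x, y, z` on its three index sets, each
summing to zero, with `x a + y b + z c ≥ 1` on the support of `s` (a *separating weight*; this is
what instability provides, `UnstableTensorBarrierTorus.lean`), Tao's slice-rank method bounds the
subrank of all Kronecker powers exponentially below `nᵐ`.

## Content

* `card_filter_le_sum_weight_le` — Hoeffding (the tree's counting form
  `Literature.NumberTheory.LFunctions.Tao2016.hoeffding_count_pi`) for the `N`-fold sum of one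
  mean-zero weight bounded by `c`: `#{a : Fin N → α | θN ≤ ∑ₗ x(aₗ)} ≤ e^{-Nθ²/(2c²)} |α|ᴺ`.
* `kroneckerPow_eq_zero_of_sepWeight_sum_lt` — on the support of `s^{⊗N}` the total weight is `≥ N`.
* `sliceRank_kroneckerPow_le_of_sepWeight` — block criterion (`sliceRank_le_of_block`) with the three
  slabs `{X ≥ θ₁N}, {Y ≥ θ₂N}, {Z ≥ θ₃N}`, `θₖ = cₖ/C`, `C = c₁ + c₂ + c₃`:
  `S(s^{⊗N}) ≤ e^{-N/(2C²)} (|α|ᴺ + |β|ᴺ + |γ|ᴺ)`.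
* `subrank_kroneckerPow_le_of_sepWeight` — for `t ≤ s` and all formats of size `≤ n`:
  `Q(t^{⊗m}) ≤ (n e^{-1/(2C²)})ᵐ` for every `m` (via `Q(t^{⊗m})ᵏ ≤ Q(t^{⊗km}) ≤ S(s^{⊗km})` and
  `k → ∞`, `le_of_pow_le_three_mul_pow`).
* `asymptoticSubrank_le_of_sepWeight` — hence `Q̃(t) ≤ n e^{-1/(2C²)}`.

## References

* M. Bläser, V. Lysikov, MFCS 2020, LIPIcs 170, 17 — §2.3, Prop. 15, Thm. 16, Thm. 17. [BlaserLysikov2020]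
* T. Tao's slice rank lemma and the block criterion: in the tree (`TricoloredSumFreeBarrier.lean`,
  `UniversalMethodBarrierSliceRank.lean`). [BlasiakChurchCohnGrochowNaslundSawinUmans2017]
* W. Hoeffding, JASA 58 (1963), Thm. 2 — in the tree (`TaoLogElliottHoeffding.lean`).
-/

noncomputable section

open scoped BigOperators

namespace Literature.Barriers.MatrixMultiplication

open Literature.Computability.AlgebraicComplexity

universe u

/-! ## Hoeffding for the `N`-fold sum of one weight -/

section Hoeffding

variable {α : Type*} [Fintype α] [DecidableEq α]

/-- **Hoeffding, one weight repeated `N` times** (counting form): for `x : α → ℝ` of total sum `0`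
with `|x| ≤ c`, `0 < c`, and `θ ≥ 0`, the number of `a : Fin N → α` with `∑ₗ x (a l) ≥ θ N` is at
most `exp(-N θ² / (2c²)) · |α|ᴺ`. [folklore] -/
theorem card_filter_le_sum_weight_le (x : α → ℝ) (hx0 : ∑ a, x a = 0) {c : ℝ} (hc : 0 < c)
    (hxc : ∀ a, |x a| ≤ c) {θ : ℝ} (hθ : 0 ≤ θ) {N : ℕ} (hN : 0 < N) :
    ((Finset.univ.filter fun a : Fin N → α => θ * N ≤ ∑ l, x (a l)).card : ℝ) ≤
      Real.exp (-(N * θ ^ 2 / (2 * c ^ 2))) * (Fintype.card α : ℝ) ^ N := by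
  have hS : 0 < ∑ _l : Fin N, c ^ 2 := by
    rw [Finset.sum_const, Finset.card_univ, Fintype.card_fin, nsmul_eq_mul]
    have : (0 : ℝ) < N := by exact_mod_cast hN
    positivity
  have h := Literature.NumberTheory.LFunctions.Tao2016.hoeffding_count_pi (κ := fun _ : Fin N => α)
    (fun _ => x) (fun _ => c) (fun _ => hx0) (fun _ a => hxc a) (t := θ * N) (by positivity) hS
  have hprod : ∏ _i : Fin N, (Fintype.card α : ℝ) = (Fintype.card α : ℝ) ^ N := by
    rw [Finset.prod_const, Finset.card_univ, Fintype.card_fin]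
  have hexp : -((θ * N) ^ 2 / (2 * ∑ _l : Fin N, c ^ 2)) = -(N * θ ^ 2 / (2 * c ^ 2)) := by
    rw [Finset.sum_const, Finset.card_univ, Fintype.card_fin, nsmul_eq_mul]
    have hN' : (N : ℝ) ≠ 0 := by exact_mod_cast hN.ne'
    field_simp
  rw [hprod, hexp] at h
  exact h

end Hoeffding

/-! ## Slice rank of powers of a tensor with a separating weight -/

section Weights

variable {K : Type u} [Field K]
variable {α β γ : Type*} [Fintype α] [Fintype β] [Fintype γ] [DecidableEq α] [DecidableEq β]
  [DecidableEq γ]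

omit [Fintype α] [Fintype β] [Fintype γ] [DecidableEq α] [DecidableEq β] [DecidableEq γ] in
/-- On the support of `s^{⊗N}` every factor `s (a l) (b l) (c l)` is non-zero, so a separating
weight (`x a + y b + z c ≥ 1` on `supp s`) has total `∑ₗ (x (a l) + y (b l) + z (c l)) ≥ N`;
contrapositive form. [cite: BlaserLysikov2020, §2.3] -/
theorem kroneckerPow_eq_zero_of_sepWeight_sum_lt (s : α → β → γ → K) (x : α → ℝ) (y : β → ℝ)
    (z : γ → ℝ) (hsep : ∀ a b c, s a b c ≠ 0 → 1 ≤ x a + y b + z c) (N : ℕ) (a : Fin N → α)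
    (b : Fin N → β) (c : Fin N → γ)
    (hlt : (∑ l, x (a l)) + (∑ l, y (b l)) + (∑ l, z (c l)) < N) :
    kroneckerPow s N a b c = 0 := by
  by_contra hne
  have hne' : ∀ l ∈ (Finset.univ : Finset (Fin N)), s (a l) (b l) (c l) ≠ 0 :=
    Finset.prod_ne_zero_iff.1 hne
  have hge : (N : ℝ) ≤ (∑ l, x (a l)) + (∑ l, y (b l)) + (∑ l, z (c l)) := by
    have h1 : ∀ l ∈ (Finset.univ : Finset (Fin N)), (1 : ℝ) ≤ x (a l) + y (b l) + z (c l) :=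
      fun l hl => hsep _ _ _ (hne' l hl)
    have h2 := Finset.sum_le_sum h1
    rw [Finset.sum_const, Finset.card_univ, Fintype.card_fin, nsmul_eq_mul, mul_one,
      Finset.sum_add_distrib, Finset.sum_add_distrib] at h2
    exact h2
  exact absurd hlt (not_lt.2 hge)

/-- **Slice rank of powers under a separating weight.** If `x, y, z` are real weights on the three
index sets of `s`, each of total sum `0`, bounded by `c₁, c₂, c₃ > 0`, with `x a + y b + z c ≥ 1`
whenever `s a b c ≠ 0`, then for every `N ≥ 1`, with `C = c₁ + c₂ + c₃`,
`S(s^{⊗N}) ≤ e^{-N/(2C²)} (|α|ᴺ + |β|ᴺ + |γ|ᴺ)` — the block criterion for the slabs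
`{∑ x ≥ (c₁/C) N}`, `{∑ y ≥ (c₂/C) N}`, `{∑ z ≥ (c₃/C) N}` and Hoeffding (BL §2.3 with [8], §4;
quantitative form of Prop. 15 / Thm. 3, direction "unstable ⇒ `S̃R < N`").
[cite: BlaserLysikov2020, Prop. 15] -/
theorem sliceRank_kroneckerPow_le_of_sepWeight (s : α → β → γ → K) (x : α → ℝ) (y : β → ℝ)
    (z : γ → ℝ) (hx0 : ∑ a, x a = 0) (hy0 : ∑ b, y b = 0) (hz0 : ∑ c, z c = 0) {c₁ c₂ c₃ : ℝ}
    (hc₁ : 0 < c₁) (hc₂ : 0 < c₂) (hc₃ : 0 < c₃) (hxc : ∀ a, |x a| ≤ c₁) (hyc : ∀ b, |y b| ≤ c₂)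
    (hzc : ∀ c, |z c| ≤ c₃) (hsep : ∀ a b c, s a b c ≠ 0 → 1 ≤ x a + y b + z c) {N : ℕ}
    (hN : 0 < N) :
    (sliceRank (kroneckerPow s N) : ℝ) ≤
      Real.exp (-(N / (2 * (c₁ + c₂ + c₃) ^ 2))) *
        ((Fintype.card α : ℝ) ^ N + (Fintype.card β : ℝ) ^ N + (Fintype.card γ : ℝ) ^ N) := by
  set C : ℝ := c₁ + c₂ + c₃ with hC
  have hCpos : 0 < C := by rw [hC]; linarith
  -- the three slabs
  set S₁ : Finset (Fin N → α) := Finset.univ.filter fun a => c₁ / C * N ≤ ∑ l, x (a l) with hS₁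
  set S₂ : Finset (Fin N → β) := Finset.univ.filter fun b => c₂ / C * N ≤ ∑ l, y (b l) with hS₂
  set S₃ : Finset (Fin N → γ) := Finset.univ.filter fun c => c₃ / C * N ≤ ∑ l, z (c l) with hS₃
  have hblock : ∀ a b c, a ∉ S₁ → b ∉ S₂ → c ∉ S₃ → kroneckerPow s N a b c = 0 := by
    intro a b c ha hb hc
    simp only [hS₁, hS₂, hS₃, Finset.mem_filter, Finset.mem_univ, true_and, not_le] at ha hb hc
    refine kroneckerPow_eq_zero_of_sepWeight_sum_lt s x y z hsep N a b c ?_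
    have hsum : c₁ / C * N + c₂ / C * N + c₃ / C * N = N := by
      rw [hC]; field_simp
    linarith
  have hSR := sliceRank_le_of_block (kroneckerPow s N) S₁ S₂ S₃ hblock
  have hSR' : (sliceRank (kroneckerPow s N) : ℝ) ≤ (S₁.card : ℝ) + S₂.card + S₃.card := by
    exact_mod_cast hSR
  -- Hoeffding for each slab; the exponents coincide: `N (cₖ/C)² / (2 cₖ²) = N / (2 C²)`
  have hexp : ∀ {c : ℝ}, 0 < c → -(N * (c / C) ^ 2 / (2 * c ^ 2)) = -(N / (2 * C ^ 2)) := by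
    intro c hc
    have hc' : c ≠ 0 := hc.ne'
    have hC' : C ≠ 0 := hCpos.ne'
    field_simp
  have h1 : (S₁.card : ℝ) ≤ Real.exp (-(N / (2 * C ^ 2))) * (Fintype.card α : ℝ) ^ N := by
    have := card_filter_le_sum_weight_le x hx0 hc₁ hxc (θ := c₁ / C) (by positivity) hN
    rwa [hexp hc₁] at this
  have h2 : (S₂.card : ℝ) ≤ Real.exp (-(N / (2 * C ^ 2))) * (Fintype.card β : ℝ) ^ N := by
    have := card_filter_le_sum_weight_le y hy0 hc₂ hyc (θ := c₂ / C) (by positivity) hN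
    rwa [hexp hc₂] at this
  have h3 : (S₃.card : ℝ) ≤ Real.exp (-(N / (2 * C ^ 2))) * (Fintype.card γ : ℝ) ^ N := by
    have := card_filter_le_sum_weight_le z hz0 hc₃ hzc (θ := c₃ / C) (by positivity) hN
    rwa [hexp hc₃] at this
  calc (sliceRank (kroneckerPow s N) : ℝ) ≤ (S₁.card : ℝ) + S₂.card + S₃.card := hSR'
    _ ≤ Real.exp (-(N / (2 * C ^ 2))) * (Fintype.card α : ℝ) ^ N +
        Real.exp (-(N / (2 * C ^ 2))) * (Fintype.card β : ℝ) ^ N +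
        Real.exp (-(N / (2 * C ^ 2))) * (Fintype.card γ : ℝ) ^ N := by linarith
    _ = _ := by ring

end Weights

/-! ## From slice rank of powers to the (asymptotic) subrank -/

section Subrank

/-- If `aᵏ ≤ 3 bᵏ` for all `k ≥ 1` (`b ≥ 0`) then `a ≤ b`. [folklore] -/
theorem le_of_pow_le_three_mul_pow {a b : ℝ} (hb : 0 ≤ b)
    (h : ∀ k : ℕ, 0 < k → a ^ k ≤ 3 * b ^ k) : a ≤ b := by
  by_contra hlt
  rw [not_le] at hlt
  rcases hb.eq_or_lt with rfl | hb0
  · have := h 1 one_pos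
    simp at this
    linarith
  · -- `(a/b)^k ≥ 1 + k (a/b - 1) > 3` for `k` large
    set r : ℝ := a / b with hr
    have hr1 : 1 < r := by rw [hr, one_lt_div hb0]; exact hlt
    obtain ⟨k, hk⟩ := exists_nat_gt (2 / (r - 1))
    have hkpos : 0 < k := by
      rcases Nat.eq_zero_or_pos k with rfl | hk0
      · have : (0 : ℝ) < 2 / (r - 1) := by apply div_pos two_pos; linarith
        simp at hk; linarith
      · exact hk0
    have hbern : 1 + (k : ℝ) * (r - 1) ≤ r ^ k := by
      have := one_add_mul_le_pow (show (-2 : ℝ) ≤ r - 1 by linarith) k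
      simpa using this
    have hgt : 3 < r ^ k := by
      have hk' : 2 < (k : ℝ) * (r - 1) := by
        have hr0 : 0 < r - 1 := by linarith
        have := (div_lt_iff₀ hr0).1 hk
        linarith
      linarith
    have hle : r ^ k ≤ 3 := by
      have hk3 := h k hkpos
      have hbk : 0 < b ^ k := pow_pos hb0 k
      rw [hr, div_pow, div_le_iff₀ hbk]
      exact hk3
    linarith

variable {K : Type u} [Field K]
variable {ι κ μ : Type*} [Fintype ι] [Fintype κ] [Fintype μ]
variable {α β γ : Type*} [Fintype α] [Fintype β] [Fintype γ] [DecidableEq α] [DecidableEq β]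
  [DecidableEq γ]

/-- **Subrank of powers under a separating weight.** Let `s ≥ t` (restriction) where `s` carries a
separating weight as in `sliceRank_kroneckerPow_le_of_sepWeight`, all three formats of `s` of size
`≤ n`. Then `Q(t^{⊗m}) ≤ (n e^{-1/(2C²)})ᵐ` for every `m`, `C = c₁ + c₂ + c₃`: indeed
`Q(t^{⊗m})ᵏ ≤ Q(t^{⊗km}) ≤ S(s^{⊗km}) ≤ 3 (n e^{-1/(2C²)})^{km}` for all `k`, and `k → ∞`.
[cite: BlaserLysikov2020, Prop. 15] -/
theorem subrank_kroneckerPow_le_of_sepWeight (t : ι → κ → μ → K) (s : α → β → γ → K)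
    (hst : TensorRestrictsTo s t) (x : α → ℝ) (y : β → ℝ) (z : γ → ℝ) (hx0 : ∑ a, x a = 0)
    (hy0 : ∑ b, y b = 0) (hz0 : ∑ c, z c = 0) {c₁ c₂ c₃ : ℝ} (hc₁ : 0 < c₁) (hc₂ : 0 < c₂)
    (hc₃ : 0 < c₃) (hxc : ∀ a, |x a| ≤ c₁) (hyc : ∀ b, |y b| ≤ c₂) (hzc : ∀ c, |z c| ≤ c₃)
    (hsep : ∀ a b c, s a b c ≠ 0 → 1 ≤ x a + y b + z c) {n : ℕ} (hα : Fintype.card α ≤ n)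
    (hβ : Fintype.card β ≤ n) (hγ : Fintype.card γ ≤ n) (m : ℕ) :
    (subrank K (kroneckerPow t m) : ℝ) ≤
      ((n : ℝ) * Real.exp (-(1 / (2 * (c₁ + c₂ + c₃) ^ 2)))) ^ m := by
  set ρ : ℝ := (n : ℝ) * Real.exp (-(1 / (2 * (c₁ + c₂ + c₃) ^ 2))) with hρ
  have hρ0 : 0 ≤ ρ := by positivity
  refine le_of_pow_le_three_mul_pow (pow_nonneg hρ0 m) fun k hk => ?_
  rcases Nat.eq_zero_or_pos m with rfl | hm
  · -- `m = 0`: `Q(t^{⊗0}) ≤ 1` (format of size `1`)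
    have h1 : subrank K (kroneckerPow t 0) ≤ 1 := by
      have := subrank_kroneckerPow_le_card_pow (K := K) t 0
      simpa using this
    have h1' : (subrank K (kroneckerPow t 0) : ℝ) ^ k ≤ 1 := by
      have : (subrank K (kroneckerPow t 0) : ℝ) ≤ 1 := by exact_mod_cast h1
      exact pow_le_one₀ (Nat.cast_nonneg _) this
    simp only [pow_zero, one_pow, mul_one]
    linarith
  -- `Q(t^{⊗m})^k ≤ Q(t^{⊗km}) ≤ S(s^{⊗km})`
  have hkm : 0 < k * m := Nat.mul_pos hk hm
  have hQ1 : subrank K (kroneckerPow t m) ^ k ≤ subrank K (kroneckerPow t (k * m)) :=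
    subrank_kroneckerPow_pow_le t k m
  have hQ2 : subrank K (kroneckerPow t (k * m)) ≤ sliceRank (kroneckerPow s (k * m)) :=
    le_sliceRank_of_restrictsTo_unitTensor
      ((hst.kroneckerPow (k * m)).trans (restrictsTo_unitTensor_subrank (kroneckerPow t (k * m))))
  have hQ : ((subrank K (kroneckerPow t m) : ℝ)) ^ k ≤ (sliceRank (kroneckerPow s (k * m)) : ℝ) := by
    exact_mod_cast hQ1.trans hQ2
  -- the slice-rank bound, with all three cardinalities replaced by `n`
  have hS := sliceRank_kroneckerPow_le_of_sepWeight s x y z hx0 hy0 hz0 hc₁ hc₂ hc₃ hxc hyc hzc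
    hsep hkm
  have hcard : (Fintype.card α : ℝ) ^ (k * m) + (Fintype.card β : ℝ) ^ (k * m) +
      (Fintype.card γ : ℝ) ^ (k * m) ≤ 3 * (n : ℝ) ^ (k * m) := by
    have ha : (Fintype.card α : ℝ) ^ (k * m) ≤ (n : ℝ) ^ (k * m) :=
      pow_le_pow_left₀ (Nat.cast_nonneg _) (by exact_mod_cast hα) _
    have hb : (Fintype.card β : ℝ) ^ (k * m) ≤ (n : ℝ) ^ (k * m) :=
      pow_le_pow_left₀ (Nat.cast_nonneg _) (by exact_mod_cast hβ) _
    have hc : (Fintype.card γ : ℝ) ^ (k * m) ≤ (n : ℝ) ^ (k * m) :=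
      pow_le_pow_left₀ (Nat.cast_nonneg _) (by exact_mod_cast hγ) _
    linarith
  have hE : 0 ≤ Real.exp (-((((k * m : ℕ) : ℝ)) / (2 * (c₁ + c₂ + c₃) ^ 2))) := (Real.exp_pos _).le
  have hmain : ((subrank K (kroneckerPow t m) : ℝ)) ^ k ≤
      3 * (Real.exp (-((((k * m : ℕ) : ℝ)) / (2 * (c₁ + c₂ + c₃) ^ 2))) * (n : ℝ) ^ (k * m)) := by
    calc ((subrank K (kroneckerPow t m) : ℝ)) ^ k ≤ (sliceRank (kroneckerPow s (k * m)) : ℝ) := hQ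
      _ ≤ _ := hS
      _ ≤ Real.exp (-((((k * m : ℕ) : ℝ)) / (2 * (c₁ + c₂ + c₃) ^ 2))) * (3 * (n : ℝ) ^ (k * m)) :=
          mul_le_mul_of_nonneg_left hcard hE
      _ = _ := by ring
  -- rewrite the right-hand side as `3 (ρ^m)^k`
  have harg : -((((k * m : ℕ) : ℝ)) / (2 * (c₁ + c₂ + c₃) ^ 2)) =
      ((k * m : ℕ) : ℝ) * (-(1 / (2 * (c₁ + c₂ + c₃) ^ 2))) := by ring
  have hrew : Real.exp (-((((k * m : ℕ) : ℝ)) / (2 * (c₁ + c₂ + c₃) ^ 2))) * (n : ℝ) ^ (k * m) =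
      (ρ ^ m) ^ k := by
    rw [harg, Real.exp_nat_mul, ← pow_mul, mul_comm m k, hρ, mul_pow, mul_comm]
  rw [hrew] at hmain
  exact hmain

/-- **Asymptotic subrank under a separating weight**: in the situation of
`subrank_kroneckerPow_le_of_sepWeight`, `Q̃(t) ≤ n e^{-1/(2C²)}` (the tree's `Q̃` is the supremum of
`Q(t^{⊗(N+1)})^{1/(N+1)}`). [cite: BlaserLysikov2020, Prop. 15] -/
theorem asymptoticSubrank_le_of_sepWeight (t : ι → κ → μ → K) (s : α → β → γ → K)
    (hst : TensorRestrictsTo s t) (x : α → ℝ) (y : β → ℝ) (z : γ → ℝ) (hx0 : ∑ a, x a = 0)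
    (hy0 : ∑ b, y b = 0) (hz0 : ∑ c, z c = 0) {c₁ c₂ c₃ : ℝ} (hc₁ : 0 < c₁) (hc₂ : 0 < c₂)
    (hc₃ : 0 < c₃) (hxc : ∀ a, |x a| ≤ c₁) (hyc : ∀ b, |y b| ≤ c₂) (hzc : ∀ c, |z c| ≤ c₃)
    (hsep : ∀ a b c, s a b c ≠ 0 → 1 ≤ x a + y b + z c) {n : ℕ} (hα : Fintype.card α ≤ n)
    (hβ : Fintype.card β ≤ n) (hγ : Fintype.card γ ≤ n) :
    asymptoticSubrank K t ≤ (n : ℝ) * Real.exp (-(1 / (2 * (c₁ + c₂ + c₃) ^ 2))) := by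
  set ρ : ℝ := (n : ℝ) * Real.exp (-(1 / (2 * (c₁ + c₂ + c₃) ^ 2))) with hρ
  have hρ0 : 0 ≤ ρ := by positivity
  refine ciSup_le fun N => ?_
  have hQ : (subrank K (kroneckerPow t (N + 1)) : ℝ) ≤ ρ ^ (N + 1) :=
    subrank_kroneckerPow_le_of_sepWeight t s hst x y z hx0 hy0 hz0 hc₁ hc₂ hc₃ hxc hyc hzc hsep
      hα hβ hγ (N + 1)
  have hexp : ((N : ℝ) + 1)⁻¹ = (((N + 1 : ℕ) : ℝ))⁻¹ := by push_cast; ring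
  calc ((subrank K (kroneckerPow t (N + 1)) : ℝ)) ^ ((N : ℝ) + 1)⁻¹
      ≤ (ρ ^ (N + 1)) ^ ((N : ℝ) + 1)⁻¹ :=
        Real.rpow_le_rpow (Nat.cast_nonneg _) hQ (by positivity)
    _ = ρ := by rw [hexp, Real.pow_rpow_inv_natCast hρ0 (Nat.succ_ne_zero N)]

end Subrank

end Literature.Barriers.MatrixMultiplication

end
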